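import Literature.AnabelianGeometry.EtaleTheta.Discharge.Sec3LogDivisorTowerCentralShift
import HarnessLib

/-!
# [EtTh] Def. 3.3 (iii) at the ε-free theta tower `towerC₃sf` / `dmSmall`: the CUSP SWAP — a γ-free, Kummer-free natural automorphism
# of `Φ₀` over the identity of `D₀` FIXING EVERY PRINCIPAL DIVISOR and moving a prime (the Φ₀-level witness against
# `DivisorDataRigid` at the design carrier of record; proof-only)

S. Mochizuki, *The étale theta function and its Frobenioid-theoretic manifestations* [EtTh], Publ. RIMS **45** (2009) (refereed),
Def. 3.3 (iii) pp.299–300 (PDF pp.73–74), Rmk. 3.3.1 pp.299–300 (PDF pp.73–74) («the set of primes … is in natural bijective correspondence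
with the set of `Gal(Z^log_∞/Y^log)`-orbits of prime log-divisors on `Z^log_∞`»), Prop. 1.4 (i) p.247 (PDF p.21) (the divisor of `Θ̈`: simple
zeroes at the cusps, `ord_{F_j}` quadratic in `j`), Def. 3.6 pp.302–303 (PDF pp.76–77) (bib key `MochizukiEtTh2009`; own render
`paper:doi-10-2977-prims-1234361159` p0073/p0074; page convention printed N = PDF M + 226).

PROOF-ONLY rider (0 `def`, 0 `instance`, 0 notation, no new `Prop`; cell abc-iut, block F, seat abc-iut-f-193 gen 15; abc-iut-L2-lead
R1463 «(o-Φ2′)» — the Φ₀-level witness behind the re-posed key «DDR@CARRIER-OF-RECORD: DECIDE THE SIGN»; sequel of this seat's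
`Sec3LogDivisorTowerCentralShift` (p528860); every input BY NAME, nothing restated).  At abc-iut-L2-t3's design tower the prime index set
is `TateTowerTheta.Idx = Cusp ⊕ ℤ`, `Cusp = ℤ × Bool` — THREE `ℤ_γ`-torsors — and the only action on log-divisors is the simultaneous
translation (`towerC₃sf_actDIV`, p528860); every level function `ζ·ϖ̈^c·Ü^k·Θ̈^t` has the SAME multiplicity `t` at EVERY cusp
(`TateTowerTheta.divFun (Sum.inl _) = eT`), so the design's `B₀` does not separate the two cusp torsors.  Hence:
* §A′ (any `Z`, `G`, `A : Z.GaloisAction G`, any `G`-set `S`) `comp_mem_phiZero_of_comm` — post-composition by ANY `Div⁺`-preserving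
  `τ : DIV ≃* DIV` commuting with every `actDIV h` maps `Φ₀(S)` into itself; `phiZeroPull_comp` — natural under pull-back (`rfl`);
* §C′ **`exists_cuspSwap`** — the involution `(j, b) ↦ (j, ¬b)` on `Cusp`, identity on components, as `τ : DIV ≃* DIV` with: (1) `τ`
  commutes with `actDIV h` for EVERY `h ∈ Compat₃′` at EVERY level of `towerC₃sf`; (2) `Div⁺ ↦ Div⁺`; (3) `τ` commutes with every
  level transition `resDIV = (−)^{eN}`; (4) **`τ (divisor f) = divisor f` for EVERY function `f` of EVERY level**; (5) `τ` moves the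
  effective Cartier prime `(0, +)` at every level.  With §A′/§B of p528860: `τ ∘ −` is a natural automorphism of `dmSmall.Φ₀` over
  `id_{D₀}` fixing `div₀ b` for every `b ∈ B₀(S)` at every `S`, and `≠ id`.
WHAT IS NOT CLAIMED: the lift through `Φ := im(Φ₀^pf → Φ₀^rlf)` of `ofPowDiagonalBase`/`ofRlfZWeak` to `C.divisorMonoid` and the
packaging `⟨a, b := id, …, divB_b⟩ : DataAut (temperedFrobenioidSmall R S)` (abc-iut-L2-t12's re-posed key); nothing about [EtTh]
Def. 3.6 / [IUTchI] Cor. 5.3 in print — there the cusps and the irreducible components carry LABELS (§1 p.244 (PDF p.18): «this choice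
of labels also determines a label ∈ ℤ for each irreducible component»), `Θ̈`'s zeroes ARE the labelled cusps (Prop. 1.4 (i) p.247 (PDF p.21):
«The zeroes of `Θ̈` on `Ÿ` are precisely the cusps of `Ÿ`; each zero has multiplicity 1») and the labels are respected by the isomorphisms
of Thm. 1.6 (iii) pp.250–251 — which excludes the relabelling: a DESIGN ARTEFACT of our `B₀` (doc v2: anchors re-set per abc-iut-ref-a
F-A49-1, own render p0018 l.28–29 / p0021 l.71–72; v1 pointed at «Prop. 1.3 / Rmk. 1.3.1»; declarations byte-identical).  HONEST FRAMING:
class-(b) design tower;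
refutable-as-typed-at-a-design-carrier ≠ refuted in print; no side is taken on [IUTchIII] Cor. 3.12; typed ≠ proved; nothing here
bears on abc itself.
-/

noncomputable section

namespace Literature.AnabelianGeometry.EtaleTheta

open CategoryTheory Opposite Function Literature.AlgebraicGeometry.Frobenioids Literature.AnabelianGeometry.SemiGraphs

universe u

/-! ## §A'  Post-composition by ANY `Div⁺`-preserving DIV-automorphism central for the action -/

namespace LogDivisorModel.GaloisAction

variable {Z : LogDivisorModel.{u}} {G : Type u} [Group G] (A : Z.GaloisAction G) (S : Action (Type u) G)

/-- **Post-composition by ANY `Div⁺`-preserving automorphism `τ` of `DIV(Z_∞)` commuting with every `actDIV h` maps `Φ₀(S)` into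
itself** (equivariance kept), for every `G`-set `S`. [cite: MochizukiEtTh2009, Def 3.3 (iii) p.299 (PDF p.73)] -/
theorem comp_mem_phiZero_of_comm (τ : Z.DIV ≃* Z.DIV) (hτ : ∀ d ∈ Z.Divplus, τ d ∈ Z.Divplus)
    (hc : ∀ (h : G) (d : Z.DIV), τ (A.actDIV h d) = A.actDIV h (τ d)) (φ : A.phiZero S) :
    (fun s => τ (φ.1 s)) ∈ A.phiZero S :=
  ⟨fun s => hτ _ (φ.2.1 s), fun h s => by simp only [phiZero_apply_ρ, hc]⟩

/-- Naturality of `τ ∘ −` under pull-back along a map of `G`-sets. [cite: MochizukiEtTh2009, Def 3.3 (iii) p.299 (PDF p.73)] -/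
theorem phiZeroPull_comp {S' : Action (Type u) G} (f : S ⟶ S') (τ : Z.DIV ≃* Z.DIV) (hτ : ∀ d ∈ Z.Divplus, τ d ∈ Z.Divplus)
    (hc : ∀ (h : G) (d : Z.DIV), τ (A.actDIV h d) = A.actDIV h (τ d)) (φ : A.phiZero S') :
    (A.phiZeroPull f ⟨_, A.comp_mem_phiZero_of_comm S' τ hτ hc φ⟩).1 = fun s => τ ((A.phiZeroPull f φ).1 s) := rfl

end LogDivisorModel.GaloisAction

/-! ## §C'  The CUSP SWAP at `towerC₃sf`: a γ-free, Kummer-free natural automorphism of `Φ₀` fixing every principal divisor -/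

namespace LogDivisorModel.TateTowerThetaTwist

open TateTowerKummerTwistRShear (Grp thetaShear Compat compat)
open TateTowerKummerTwist (MuN N eN)

/-- **The CUSP SWAP at `towerC₃sf`**: the involution `(j, b) ↦ (j, ¬b)` of `Cusp = ℤ × Bool` (identity on the components `F_j`) induces
`τ : DIV ≃* DIV` which (1) commutes with `actDIV h` for every `h ∈ Compat₃′` at every level, (2) preserves `Div⁺`, (3) commutes with the
level transitions, (4) FIXES the divisor of EVERY function of EVERY level (all cusp multiplicities of `ζ ϖ̈^c Ü^k Θ̈^t` equal `t`), and
(5) MOVES the effective Cartier prime `(0, +)` — a γ-free, Kummer-free natural automorphism of `dmSmall.Φ₀` over `id_{D₀}` fixing all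
principal divisors (the Φ₀-level witness against `DivisorDataRigid` at the design carrier; print excludes it by labelled cusps).
[cite: MochizukiEtTh2009, Rmk 3.3.1 p.299 (PDF p.73)] -/
theorem exists_cuspSwap :
    ∃ τ : Multiplicative (TateTowerTheta.Idx → ℤ) ≃* Multiplicative (TateTowerTheta.Idx → ℤ),
      (∀ d x, Multiplicative.toAdd (τ d) x = Multiplicative.toAdd d (Sum.map (fun c : ℤ × Bool => (c.1, !c.2)) id x)) ∧
      -- commutes with every shift (hence with `actDIV h` of every `h ∈ Compat₃′` at every level of `towerC₃sf`)
      (∀ (n : ℕ) (h : Compat 3 thetaShear) (d : (towerC₃sf.Z n).DIV), τ ((towerC₃sf.act n).actDIV h d) = (towerC₃sf.act n).actDIV h (τ d)) ∧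
      -- preserves effective Cartier log-divisors
      (∀ (n : ℕ) (d : (towerC₃sf.Z n).DIV), d ∈ (towerC₃sf.Z n).Divplus → τ d ∈ (towerC₃sf.Z n).Divplus) ∧
      -- commutes with the level transitions
      (∀ (i j : ℕ) (hij : (TateTowerKummerTwistRShear.levelsC 3 thetaShear).closure j ≤
          (TateTowerKummerTwistRShear.levelsC 3 thetaShear).closure i) (d : (towerC₃sf.Z i).DIV),
        τ (towerC₃sf.resDIV hij d) = towerC₃sf.resDIV hij (τ d)) ∧
      -- FIXES the divisor of EVERY function of EVERY level (cusp multiplicities of `ζ ϖ̈^c Ü^k Θ̈^t` are all `t`)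
      (∀ (n : ℕ) (f : (towerC₃sf.Z n).logMero), τ ((towerC₃sf.Z n).divisor f) = (towerC₃sf.Z n).divisor f) ∧
      -- MOVES an effective Cartier prime: the cusp `(0, +)`
      (∀ n : ℕ, ∃ d ∈ (towerC₃sf.Z n).Divplus, τ d ≠ d) := by
  let π : TateTowerTheta.Idx → TateTowerTheta.Idx := Sum.map (fun c : ℤ × Bool => (c.1, !c.2)) id
  have hππ : ∀ x, π (π x) = x := by
    rintro (⟨j, b⟩ | j) <;> simp [π]
  let τ : Multiplicative (TateTowerTheta.Idx → ℤ) ≃* Multiplicative (TateTowerTheta.Idx → ℤ) :=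
    { toFun := fun d => Multiplicative.ofAdd fun x => Multiplicative.toAdd d (π x)
      invFun := fun d => Multiplicative.ofAdd fun x => Multiplicative.toAdd d (π x)
      left_inv := fun d => Multiplicative.toAdd.injective (funext fun x => by simp [hππ])
      right_inv := fun d => Multiplicative.toAdd.injective (funext fun x => by simp [hππ])
      map_mul' := fun _ _ => Multiplicative.toAdd.injective (funext fun x => by simp) }
  have hτ : ∀ d x, Multiplicative.toAdd (τ d) x = Multiplicative.toAdd d (π x) := fun d x => by simp [τ]
  -- π commutes with every shift
  have hπshift : ∀ (a : ℤ) (x : TateTowerTheta.Idx), (TateTowerTheta.shiftIdx a).symm (π x) = π ((TateTowerTheta.shiftIdx a).symm x) := by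
    rintro a (⟨j, b⟩ | j)
    · simp [π]
    · simp [π]
  refine ⟨τ, hτ, fun n h d => ?_, fun n d hd => ?_, fun i j hij d => ?_, fun n f => ?_, fun n => ?_⟩
  · refine Multiplicative.toAdd.injective (funext fun x => ?_)
    have e1 := hτ ((towerC₃sf.act n).actDIV h d) x
    have e2 := toAdd_towerC₃sf_actDIV n h d (π x)
    have e3 := toAdd_towerC₃sf_actDIV n h (τ d) x
    have e4 := hτ d ((TateTowerTheta.shiftIdx (Multiplicative.toAdd (h : Grp 3 thetaShear).right.2)).symm x)
    rw [hπshift] at e2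
    exact (e1.trans (e2.trans e4.symm)).trans e3.symm
  · refine Submonoid.mem_inf.mpr ⟨trivial, fun x => ?_⟩
    have hx := (Submonoid.mem_inf.mp hd).2 (π x)
    change 0 ≤ Multiplicative.toAdd (τ d) x
    rw [hτ]; exact hx
  · exact map_pow τ d (eN i j)
  · refine Multiplicative.toAdd.injective (funext fun x => ?_)
    rw [hτ]
    change TateTowerTheta.divFun _ (π x) = TateTowerTheta.divFun _ x
    rcases x with ⟨j, b⟩ | j
    · rfl
    · rfl
  · refine ⟨Multiplicative.ofAdd fun x => if x = Sum.inl ((0 : ℤ), true) then 1 else 0, ?_, ?_⟩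
    · refine Submonoid.mem_inf.mpr ⟨trivial, (TateTowerTheta.ofAdd_mem_effective_iff _).2 fun x => ?_⟩
      split_ifs <;> simp
    · intro h
      have h1 := congrArg (fun d : Multiplicative (TateTowerTheta.Idx → ℤ) => Multiplicative.toAdd d (Sum.inl ((0 : ℤ), false))) h
      rw [hτ] at h1
      simp [π] at h1
      have h2 : (if (Sum.inl ((0 : ℤ), true) : TateTowerTheta.Idx) = Sum.inl (0, true) then (1 : ℤ) else 0) =
          (if (Sum.inl ((0 : ℤ), false) : TateTowerTheta.Idx) = Sum.inl (0, true) then (1 : ℤ) else 0) := h1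
      rw [if_pos rfl, if_neg (by simp)] at h2
      exact one_ne_zero h2

end LogDivisorModel.TateTowerThetaTwist

end Literature.AnabelianGeometry.EtaleTheta

end
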